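import Summits.QuantumFields.YangMills.Theorems.BalabanLadderNTCanonicalKernel
import HarnessLib

/-!
# Crux `NT` (stmt-QuantumFields-19353), stub `stub_refpkgT : RefPkgT`: CANONICAL ENVELOPES IV — triple Riemann sums and the
# generic pair kernel term of the registered clause-5 margin

Helper file (`--supports stmt-QuantumFields-19353`) of the fleet lead prover of crux `NT` (unit `ym-spine-19353-p1`, GEN 12);
sequel of `…NTCanonicalKernel`.  Hypothesis-free; pure real analysis on the witness side.

* `sum_piFinset_three`, `mem_box₃_of_apply_ne_zero`, `sum_box₃_eq_of_cover`, `tendsto_latticeSum₃_seq`, **`tendsto_latticeSum₃`**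
  — triple Riemann sums `a¹² Σ_{x,y,z ∈ box L} g(a x, a y, a z) → ∫ g` (tree `Sketch.tendsto_riemann_sum`, `N = 3`);
* **`pairTerm_tendsto_canonical`** — for two Schwartz witnesses `F, H` with supports `δ'` apart inside the ball of radius `σ`:
  `a⁴ Σ_{y,z} |F(a y)||H(a z)|/(1+‖z−y‖)⁴ → ∫_{(ℝ⁴)²}|F(p₀)||H(p₁)|/‖p₁−p₀‖⁴` (the generic form of `marginE2_tendsto_canonical`);
(the triple `min`-distance kernel term of E3 follows in `…NTCanonicalKernelThree`).

HONEST FRAMING.  Riemann sums and elementary kernel estimates; nothing about floors, ceilings, AF, NT, the seam or the gap; not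
Clay.  Refs: GlimmJaffe1987 §6.1.
-/

set_option autoImplicit false

noncomputable section

open scoped SchwartzMap
open MeasureTheory Filter Topology
open Literature.MathematicalPhysics.QuantumFieldTheory Literature.MathematicalPhysics.QuantumLattice
open Literature.Probability.LatticeModels
open Summit.QuantumFields.YangMills.Theorems.OSLegsFromFemtoAndGap (mul_norm_le_norm_smul_siteToE)
open Summit.QuantumFields.YangMills.Cruxes.OSLegsAtWeakCouplingC.Sketch (tendsto_riemann_sum)
open Summit.QuantumFields.YangMills.Cruxes.NT.Reference (norm_smul_siteToE_sub)

namespace Summit.QuantumFields.YangMills.Cruxes.NT.CeilingPrice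

/-! ## §1 Triple Riemann sums -/

section Riemann

/-- Sums over `(Fin 3 → ι)`-indexed boxes are triple sums. [folklore] -/
theorem sum_piFinset_three {ι : Type*} [DecidableEq ι] (B : Finset ι) (Φ : (Fin 3 → ι) → ℝ) :
    ∑ p ∈ Fintype.piFinset (fun _ : Fin 3 => B), Φ p = ∑ x ∈ B, ∑ y ∈ B, ∑ z ∈ B, Φ ![x, y, z] := by
  have e : ∑ x ∈ B, ∑ y ∈ B, ∑ z ∈ B, Φ ![x, y, z] = ∑ q ∈ B ×ˢ (B ×ˢ B), Φ ![q.1, q.2.1, q.2.2] := by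
    rw [Finset.sum_product]
    refine Finset.sum_congr rfl fun x _ => ?_
    rw [Finset.sum_product]
  rw [e]
  refine Finset.sum_nbij' (fun p => (p 0, (p 1, p 2))) (fun q => ![q.1, q.2.1, q.2.2]) (fun p hp => ?_)
    (fun q hq => ?_) (fun p _ => ?_) (fun q _ => ?_) (fun p _ => ?_)
  · rw [Fintype.mem_piFinset] at hp
    simp [Finset.mem_product, hp]
  · simp only [Finset.mem_product] at hq
    rw [Fintype.mem_piFinset]
    intro i
    fin_cases i
    · simpa using hq.1
    · simpa using hq.2.1
    · simpa using hq.2.2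
  · ext i; fin_cases i <;> rfl
  · simp
  · have : p = ![p 0, p 1, p 2] := by ext i; fin_cases i <;> rfl
    exact congrArg Φ this

/-- A triple charged by a function supported in the pi-ball of radius `ρ` (spacing `s > 0`) lies in `(box L)³` once `ρ ≤ s·L`.
[folklore] -/
theorem mem_box₃_of_apply_ne_zero {g : (Fin 3 → EuclideanSpace ℝ (Fin 4)) → ℝ} {ρ s : ℝ} (hs : 0 < s)
    (hg : tsupport g ⊆ Metric.closedBall 0 ρ) {L : ℕ} (hL : ρ ≤ s * L) {x y z : Fin 4 → ℤ}
    (hxyz : g (fun i => s • siteToE (![x, y, z] i)) ≠ 0) : x ∈ box 4 L ∧ y ∈ box 4 L ∧ z ∈ box 4 L := by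
  have hmem := hg (subset_tsupport _ (Function.mem_support.2 hxyz))
  rw [Metric.mem_closedBall, dist_zero_right] at hmem
  have key : ∀ w : Fin 4 → ℤ, ‖s • siteToE w‖ ≤ ρ → w ∈ box 4 L := fun w hw => by
    have h1 : s * ‖w‖ ≤ ‖s • siteToE w‖ := mul_norm_le_norm_smul_siteToE hs.le w
    have h3 : ‖w‖ ≤ L := le_of_mul_le_mul_left (by linarith) hs
    refine mem_box.2 fun j => ?_
    have h4 : (‖w j‖ : ℝ) ≤ ‖w‖ := norm_le_pi_norm w j
    rw [Int.norm_eq_abs] at h4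
    have h5 := abs_le.1 (h4.trans h3)
    exact ⟨by exact_mod_cast h5.1, by exact_mod_cast h5.2⟩
  have h0 := norm_le_pi_norm (fun i => s • siteToE (![x, y, z] i)) 0
  have h1 := norm_le_pi_norm (fun i => s • siteToE (![x, y, z] i)) 1
  have h2 := norm_le_pi_norm (fun i => s • siteToE (![x, y, z] i)) 2
  simp only [Matrix.cons_val_zero, Matrix.cons_val_one, Matrix.cons_val] at h0 h1 h2
  exact ⟨key x (h0.trans hmem), key y (h1.trans hmem), key z (h2.trans hmem)⟩

/-- **Larger boxes do not change the triple sum** of a function supported in the pi-ball of radius `ρ ≤ s·L`. [folklore] -/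
theorem sum_box₃_eq_of_cover {g : (Fin 3 → EuclideanSpace ℝ (Fin 4)) → ℝ} {ρ s : ℝ} (hs : 0 < s)
    (hg : tsupport g ⊆ Metric.closedBall 0 ρ) {L L' : ℕ} (hL : ρ ≤ s * L) (hLL' : L ≤ L') :
    ∑ x ∈ box 4 L', ∑ y ∈ box 4 L', ∑ z ∈ box 4 L', g (fun i => s • siteToE (![x, y, z] i)) =
      ∑ x ∈ box 4 L, ∑ y ∈ box 4 L, ∑ z ∈ box 4 L, g (fun i => s • siteToE (![x, y, z] i)) := by
  have hsub : box 4 L ⊆ box 4 L' := fun w hw => by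
    rw [mem_box] at hw ⊢
    intro j
    have := hw j
    constructor <;> [linarith [this.1, (Nat.cast_le (α := ℤ)).2 hLL']; linarith [this.2, (Nat.cast_le (α := ℤ)).2 hLL']]
  have hzero : ∀ x y z : Fin 4 → ℤ, ¬ (x ∈ box 4 L ∧ y ∈ box 4 L ∧ z ∈ box 4 L) →
      g (fun i => s • siteToE (![x, y, z] i)) = 0 := by
    intro x y z hn
    by_contra hne
    exact hn (mem_box₃_of_apply_ne_zero hs hg hL hne)
  symm
  refine (Finset.sum_subset hsub (fun x _ hx => Finset.sum_eq_zero fun y _ =>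
    Finset.sum_eq_zero fun z _ => hzero x y z fun h => hx h.1)).trans ?_
  refine Finset.sum_congr rfl fun x _ => ?_
  refine (Finset.sum_subset hsub (fun y _ hy => Finset.sum_eq_zero fun z _ => hzero x y z fun h => hy h.2.1)).trans ?_
  refine Finset.sum_congr rfl fun y _ => ?_
  exact Finset.sum_subset hsub fun z _ hz => hzero x y z fun h => hz h.2.2

/-- **Triple Riemann sums along a sequence**: `a_k¹² Σ_{x,y,z ∈ box L_k} g(a_k x, a_k y, a_k z) → ∫ g` for `g` continuous with
`tsupport g ⊆ closedBall 0 ρ`, `a_k > 0`, `a_k → 0`, `ρ ≤ a_k L_k` eventually. [cite: GlimmJaffe1987, §6.1] -/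
theorem tendsto_latticeSum₃_seq {g : (Fin 3 → EuclideanSpace ℝ (Fin 4)) → ℝ} (hgc : Continuous g) {ρ : ℝ}
    (hg : tsupport g ⊆ Metric.closedBall 0 ρ) (a : ℕ → ℝ) (L : ℕ → ℕ) (ha : ∀ k, 0 < a k)
    (ha0 : Tendsto a atTop (𝓝 0)) (hL : ∀ᶠ k in atTop, ρ ≤ a k * L k) :
    Tendsto (fun k => a k ^ 12 * ∑ x ∈ box 4 (L k), ∑ y ∈ box 4 (L k), ∑ z ∈ box 4 (L k),
      g (fun i => a k • siteToE (![x, y, z] i))) atTop (𝓝 (∫ p, g p)) := by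
  classical
  have hgK : HasCompactSupport g :=
    (isCompact_closedBall (0 : Fin 3 → EuclideanSpace ℝ (Fin 4)) ρ).of_isClosed_subset (isClosed_tsupport _) hg
  set L' : ℕ → ℕ := fun k => L k + ⌈(k : ℝ) / a k⌉₊ with hL'_def
  have haL' : Tendsto (fun k => a k * L' k) atTop atTop := by
    refine tendsto_atTop_mono (fun k => ?_) tendsto_natCast_atTop_atTop
    have h1 : (k : ℝ) / a k ≤ ⌈(k : ℝ) / a k⌉₊ := Nat.le_ceil _
    have h2 : (⌈(k : ℝ) / a k⌉₊ : ℝ) ≤ (L' k : ℝ) := by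
      rw [hL'_def]; push_cast; linarith [Nat.cast_nonneg (α := ℝ) (L k)]
    calc (k : ℝ) = a k * ((k : ℝ) / a k) := by field_simp [(ha k).ne']
      _ ≤ a k * L' k := mul_le_mul_of_nonneg_left (h1.trans h2) (ha k).le
  have key := tendsto_riemann_sum g hgc hgK a L' ha ha0 haL'
  have hsum : ∀ (b : ℝ) (B : Finset (Fin 4 → ℤ)),
      ∑ p ∈ Fintype.piFinset (fun _ : Fin 3 => B), g (fun i => b • siteToE (p i)) =
        ∑ x ∈ B, ∑ y ∈ B, ∑ z ∈ B, g (fun i => b • siteToE (![x, y, z] i)) := fun b B =>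
    sum_piFinset_three B (fun p => g (fun i => b • siteToE (p i)))
  simp_rw [hsum, show 4 * 3 = 12 from rfl] at key
  refine key.congr' ?_
  filter_upwards [hL] with k hk
  rw [sum_box₃_eq_of_cover (ha k) hg hk (Nat.le_add_right _ _)]

/-- **Triple Riemann sums along the coupling**: the same along `atTop : Filter ℝ` for a unit map `a > 0`, `a → 0` and boxes
with `ρ ≤ a β·L β` eventually. [cite: GlimmJaffe1987, §6.1] -/
theorem tendsto_latticeSum₃ {g : (Fin 3 → EuclideanSpace ℝ (Fin 4)) → ℝ} (hgc : Continuous g) {ρ : ℝ}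
    (hg : tsupport g ⊆ Metric.closedBall 0 ρ) (a : ℝ → ℝ) (L : ℝ → ℕ) (ha : ∀ β, 0 < a β)
    (ha0 : Tendsto a atTop (𝓝 0)) (hL : ∀ᶠ β in atTop, ρ ≤ a β * L β) :
    Tendsto (fun β => a β ^ 12 * ∑ x ∈ box 4 (L β), ∑ y ∈ box 4 (L β), ∑ z ∈ box 4 (L β),
      g (fun i => a β • siteToE (![x, y, z] i))) atTop (𝓝 (∫ p, g p)) := by
  rw [tendsto_iff_seq_tendsto]
  intro u hu
  exact tendsto_latticeSum₃_seq hgc hg (a ∘ u) (L ∘ u) (fun k => ha _) (ha0.comp hu) (hu.eventually hL)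

end Riemann

/-! ## §2 The generic pair term -/

section Pair

variable {F H : 𝓢(EuclideanSpace ℝ (Fin 4), ℝ)} {δ' σ : ℝ}

/-- The pair kernel of two `δ'`-separated witnesses equals its `max(‖·‖, δ')`-regularisation. [folklore] -/
theorem pairKernel_eq_max' (hFH : ∀ p q : EuclideanSpace ℝ (Fin 4), F p ≠ 0 → H q ≠ 0 → δ' ≤ ‖p - q‖) (t : ℝ)
    (p : Fin 2 → EuclideanSpace ℝ (Fin 4)) :
    |F (p 0)| * |H (p 1)| / (t + ‖p 1 - p 0‖) ^ 4 = |F (p 0)| * |H (p 1)| / (t + max ‖p 1 - p 0‖ δ') ^ 4 := by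
  by_cases h₀ : F (p 0) = 0
  · simp [h₀]
  by_cases h₁ : H (p 1) = 0
  · simp [h₁]
  have h := hFH _ _ h₀ h₁
  rw [norm_sub_rev] at h
  rw [max_eq_left h]

/-- **The generic pair term is canonically `∫∫|F||H|/‖·‖⁴`**: for Schwartz witnesses `F, H` with supports `δ' > 0` apart inside
the ball of radius `σ ≥ 0`, along any unit map `a > 0`, `a → 0` and boxes covering the support,
`a⁴ Σ_{y,z ∈ box} |F(a y)||H(a z)|/(1+‖z−y‖)⁴ → ∫_{(ℝ⁴)²} |F(p₀)||H(p₁)|/‖p₁−p₀‖⁴`. [cite: GlimmJaffe1987, §6.1] -/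
theorem pairTerm_tendsto_canonical (hδ' : 0 < δ') (hσ : 0 ≤ σ)
    (hFH : ∀ p q : EuclideanSpace ℝ (Fin 4), F p ≠ 0 → H q ≠ 0 → δ' ≤ ‖p - q‖)
    (hFσ : tsupport (F : EuclideanSpace ℝ (Fin 4) → ℝ) ⊆ Metric.closedBall 0 σ)
    (hHσ : tsupport (H : EuclideanSpace ℝ (Fin 4) → ℝ) ⊆ Metric.closedBall 0 σ) (a : ℝ → ℝ) (L : ℝ → ℕ)
    (ha : ∀ β, 0 < a β) (ha0 : Tendsto a atTop (𝓝 0)) (hL : ∀ᶠ β in atTop, σ ≤ a β * L β) :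
    Tendsto (fun β => a β ^ 4 * ∑ y ∈ box 4 (L β), ∑ z ∈ box 4 (L β),
        |F (a β • siteToE y)| * |H (a β • siteToE z)| / (1 + ‖siteToE (z - y)‖) ^ 4) atTop
      (𝓝 (∫ p : Fin 2 → EuclideanSpace ℝ (Fin 4), |F (p 0)| * |H (p 1)| / ‖p 1 - p 0‖ ^ 4)) := by
  set K : ℝ → (Fin 2 → EuclideanSpace ℝ (Fin 4)) → ℝ := fun t p =>
    |F (p 0)| * |H (p 1)| / (t + max ‖p 1 - p 0‖ δ') ^ 4 with hK
  -- (1) lattice term = a⁸ ΣΣ K_a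
  have hlat : ∀ β, a β ^ 4 * ∑ y ∈ box 4 (L β), ∑ z ∈ box 4 (L β),
      |F (a β • siteToE y)| * |H (a β • siteToE z)| / (1 + ‖siteToE (z - y)‖) ^ 4 =
      a β ^ 8 * ∑ y ∈ box 4 (L β), ∑ z ∈ box 4 (L β), K (a β) (fun i => a β • siteToE (![y, z] i)) := by
    intro β
    have hs := ha β
    rw [Finset.mul_sum, Finset.mul_sum]
    refine Finset.sum_congr rfl fun y _ => ?_
    rw [Finset.mul_sum, Finset.mul_sum]
    refine Finset.sum_congr rfl fun z _ => ?_
    have e1 : K (a β) (fun i => a β • siteToE (![y, z] i)) =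
        |F (a β • siteToE y)| * |H (a β • siteToE z)| / (a β + ‖a β • siteToE z - a β • siteToE y‖) ^ 4 := by
      simp only [hK, Matrix.cons_val_zero, Matrix.cons_val_one]
      exact (pairKernel_eq_max' hFH (a β) ![a β • siteToE y, a β • siteToE z]).symm
    rw [e1, norm_smul_siteToE_sub (a β) hs y z]
    have hden : 0 < 1 + ‖siteToE (z - y)‖ := by positivity
    field_simp
  simp_rw [hlat]
  -- (2) K 0 is continuous with compact support: Riemann limit
  have hKc : Continuous (K 0) := by
    refine Continuous.div ?_ ?_ fun p => ?_
    · exact ((F.continuous.comp (continuous_apply 0)).abs).mul ((H.continuous.comp (continuous_apply 1)).abs)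
    · exact (continuous_const.add ((((continuous_apply 1).sub (continuous_apply 0)).norm).max
        continuous_const)).pow 4
    · have : δ' ≤ 0 + max ‖p 1 - p 0‖ δ' := by rw [zero_add]; exact le_max_right _ _
      exact (pow_pos (by linarith) 4).ne'
  have hKs : tsupport (K 0) ⊆ Metric.closedBall 0 σ := by
    refine closure_minimal (fun p hp => ?_) Metric.isClosed_closedBall
    have h₀ : F (p 0) ≠ 0 := fun h => hp (by simp [hK, h])
    have h₁ : H (p 1) ≠ 0 := fun h => hp (by simp [hK, h])
    have hb₀ := hFσ (subset_tsupport _ (Function.mem_support.2 h₀))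
    have hb₁ := hHσ (subset_tsupport _ (Function.mem_support.2 h₁))
    rw [Metric.mem_closedBall, dist_zero_right] at hb₀ hb₁ ⊢
    refine (pi_norm_le_iff_of_nonneg hσ).2 fun i => ?_
    fin_cases i
    · exact hb₀
    · exact hb₁
  have hmain := tendsto_latticeSum₂ hKc hKs a L ha ha0 hL
  have hint : ∫ p, K 0 p = ∫ p : Fin 2 → EuclideanSpace ℝ (Fin 4), |F (p 0)| * |H (p 1)| / ‖p 1 - p 0‖ ^ 4 := by
    refine integral_congr_ae (Eventually.of_forall fun p => ?_)
    have h := pairKernel_eq_max' hFH 0 p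
    simp only [zero_add] at h
    simp only [hK, zero_add]
    exact h.symm
  rw [← hint]
  -- (3) the error term
  have herr : Tendsto (fun β => a β ^ 8 * ∑ y ∈ box 4 (L β), ∑ z ∈ box 4 (L β),
      K 0 (fun i => a β • siteToE (![y, z] i)) -
      a β ^ 8 * ∑ y ∈ box 4 (L β), ∑ z ∈ box 4 (L β), K (a β) (fun i => a β • siteToE (![y, z] i))) atTop (𝓝 0) := by
    have hF1 := tendsto_envelope F hFσ a L ha ha0 hL
    have hH1 := tendsto_envelope H hHσ a L ha ha0 hL
    have hbound : Tendsto (fun β => 4 * a β / δ' ^ 5 *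
        ((a β ^ 4 * ∑ y ∈ box 4 (L β), |F (a β • siteToE y)|) *
          (a β ^ 4 * ∑ z ∈ box 4 (L β), |H (a β • siteToE z)|))) atTop (𝓝 0) := by
      have h1 : Tendsto (fun β => 4 * a β / δ' ^ 5) atTop (𝓝 (4 * 0 / δ' ^ 5)) := (ha0.const_mul 4).div_const _
      rw [mul_zero, zero_div] at h1
      simpa using h1.mul (hF1.mul hH1)
    refine squeeze_zero_norm' (Eventually.of_forall fun β => ?_) hbound
    have hs := ha β
    rw [Real.norm_eq_abs, ← mul_sub, ← Finset.sum_sub_distrib]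
    simp_rw [← Finset.sum_sub_distrib]
    have hpt : ∀ y z : Fin 4 → ℤ, |K 0 (fun i => a β • siteToE (![y, z] i)) - K (a β) (fun i => a β • siteToE (![y, z] i))|
        ≤ 4 * a β / δ' ^ 5 * (|F (a β • siteToE y)| * |H (a β • siteToE z)|) := by
      intro y z
      simp only [hK, Matrix.cons_val_zero, Matrix.cons_val_one, zero_add]
      set m := max ‖a β • siteToE z - a β • siteToE y‖ δ' with hm
      have hm2 : δ' ≤ m := le_max_right _ _
      have hm0 : 0 < m := by linarith
      set A := |F (a β • siteToE y)| * |H (a β • siteToE z)| with hA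
      have hA0 : 0 ≤ A := by positivity
      rw [div_eq_mul_one_div A, div_eq_mul_one_div A (_ ^ 4), ← mul_sub]
      rw [abs_of_nonneg (mul_nonneg hA0 (by
        rw [sub_nonneg]
        exact one_div_le_one_div_of_le (pow_pos hm0 4) (pow_le_pow_left₀ hm0.le (by linarith) 4)))]
      rw [mul_comm (4 * a β / δ' ^ 5) A]
      refine mul_le_mul_of_nonneg_left ?_ hA0
      calc 1 / m ^ 4 - 1 / (a β + m) ^ 4 ≤ 4 * a β / m ^ 5 := one_div_pow_four_sub_le hm0 hs.le
        _ ≤ 4 * a β / δ' ^ 5 :=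
            div_le_div_of_nonneg_left (by linarith) (pow_pos hδ' 5) (pow_le_pow_left₀ hδ'.le hm2 5)
    calc |a β ^ 8 * ∑ y ∈ box 4 (L β), ∑ z ∈ box 4 (L β),
          (K 0 (fun i => a β • siteToE (![y, z] i)) - K (a β) (fun i => a β • siteToE (![y, z] i)))|
        = a β ^ 8 * |∑ y ∈ box 4 (L β), ∑ z ∈ box 4 (L β),
          (K 0 (fun i => a β • siteToE (![y, z] i)) - K (a β) (fun i => a β • siteToE (![y, z] i)))| := by
          rw [abs_mul, abs_of_pos (pow_pos hs 8)]
      _ ≤ a β ^ 8 * ∑ y ∈ box 4 (L β), ∑ z ∈ box 4 (L β),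
          4 * a β / δ' ^ 5 * (|F (a β • siteToE y)| * |H (a β • siteToE z)|) := by
          refine mul_le_mul_of_nonneg_left ?_ (pow_nonneg hs.le 8)
          refine (Finset.abs_sum_le_sum_abs _ _).trans (Finset.sum_le_sum fun y _ => ?_)
          exact (Finset.abs_sum_le_sum_abs _ _).trans (Finset.sum_le_sum fun z _ => hpt y z)
      _ = 4 * a β / δ' ^ 5 * ((a β ^ 4 * ∑ y ∈ box 4 (L β), |F (a β • siteToE y)|) *
          (a β ^ 4 * ∑ z ∈ box 4 (L β), |H (a β • siteToE z)|)) := by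
          have e : ∑ y ∈ box 4 (L β), ∑ z ∈ box 4 (L β),
              4 * a β / δ' ^ 5 * (|F (a β • siteToE y)| * |H (a β • siteToE z)|) =
              4 * a β / δ' ^ 5 * ((∑ y ∈ box 4 (L β), |F (a β • siteToE y)|) *
                (∑ z ∈ box 4 (L β), |H (a β • siteToE z)|)) := by
            rw [Finset.sum_mul_sum, Finset.mul_sum]
            refine Finset.sum_congr rfl fun y _ => ?_
            rw [Finset.mul_sum]
          rw [e]
          ring
  have := hmain.sub herr
  simp only [sub_sub_cancel, sub_zero] at this
  exact this

end Pair

end Summit.QuantumFields.YangMills.Cruxes.NT.CeilingPrice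

end
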